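import Mathlib
import HarnessLib
import HarnessLib.Audit
import Summits.HodgeConjecture.HodgeConjecture.Theorems.NikulinTwinTransportTwinTwistorTransportReduction
import Summits.HodgeConjecture.HodgeConjecture.Theorems.NikulinTwinTransportTwinTwistorTransportPeriodInvariance
import Summits.HodgeConjecture.HodgeConjecture.Theorems.NikulinTwinTransportTwinTwistorTransportPolarisedCmNormPeriod
import Summits.HodgeConjecture.HodgeConjecture.Theorems.NikulinTwinTransportTwinTwistorTransportCmTwinAnchor
import Summits.HodgeConjecture.HodgeConjecture.Theorems.TwinTwistorTransport.Negative.NoOddSelfAnchor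
import Summits.HodgeConjecture.HodgeConjecture.Theorems.TwinTwistorTransport.Negative.TypedClauseHygiene
import Summits.HodgeConjecture.HodgeConjecture.Theorems.TwinTwistorTransport.Negative.WithoutRationalityOrHalving
import Literature.AlgebraicGeometry.Crystalline.PadicAnchorDefs
import Literature.AlgebraicGeometry.Surfaces.K3ComplexMultiplication
import Literature.AlgebraicGeometry.Surfaces.K3HodgeTypesHolds
import Literature.AlgebraicGeometry.Surfaces.K3SurfaceBuskinLeaves
import Literature.AlgebraicGeometry.HodgeTheory.GysinBaseChange
import Literature.AlgebraicGeometry.HodgeTheory.AbsoluteHodgeClasses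
import Literature.NumberTheory.Transcendental.DeRhamTheorem
import Literature.NumberTheory.Transcendental.DeRhamTheoremMultiplicative
import Summits.HodgeConjecture.HodgeConjecture.Theorems.PadicSemiregularLiftHodgeAbelianVarietiesStarSeedsEngine
import Summits.HodgeConjecture.HodgeConjecture.Theses.PadicSemiregularLift

/-!
# LEAD RESHAPE r5 (prover-line-stmt-HodgeConjecture-14393-c5-0, 2026-08-16, terminal audit of the line): the interim sorried copies of the two
# LANDED anchor stubs are GONE — `Theorems/NikulinTwinTransportTwinTwistorTransportPolarisedCmNormPeriod.lean` (p109597) and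
# `Theorems/NikulinTwinTransportTwinTwistorTransportCmTwinAnchor.lean` (p109741) are imported and `Stub.stub_polarisedCmNormPeriod`,
# `Stub.stub_cmTwinAnchor` are the landed theorems. Registered stubs after r5 (4): `stub_facts` (named Literature facts),
# `stub_divisorialDiscModels` (XL definition gap: W(k)-models / universal polarised twin family), `stub_twinFormalSeeds` (THE HEART:
# object-level p-adic lifting of a carrier of the specialised twin class — research-open, no source; see Lines/ordinary-prime-anchors-dead.md),
# `stub_discSpread` (XL definition gap). Nothing else is open.
#
# LEAD RESHAPE r2/r3/r4 — INTERIM FILE r3i: the two LANDED anchor stubs are kept as sorried registered copies until the farm has built their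
# modules (p109597, p109741 accepted 14:4xZ; farm state stale at 15:xxZ); then they are imported (file r3) (lead prover-line-stmt-HodgeConjecture-14393-c2-0, 2026-08-16, after wave 1) of the planner's checked skeleton

r4 (lead): the ordinarity hypothesis `D.IsOrdinary`, IDLE in every typed statement of r1–r3 (nothing consumed it), is REPLACED in the heart and in
`ModelAt` by the DIVISORIAL special fibre (`PadicAnchor.DivisorClassesAreChern`, `PadicAnchor.RationallyLefschetz` — supersingular reduction of the CM
anchor at inert primes, Tate for supersingular K3 + Künneth): the one piece of structure the object search can use (`u` becomes a polynomial in `c₁` of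
line bundles), aligning the heart with the sibling route's seed problem at supersingular anchors; model stub renamed `stub_divisorialDiscModels`.

r3 (lead, heart cut along the sibling engine): the planner's heart `stub_twinPVHC` (rational `p`-adic variational Hodge for the twin class) is
SPLIT TIGHTLY into the smaller research stub `stub_twinFormalSeeds` (on a genuine ordinary twin model with rational algebraic `u = sp(γ)`, a non-zero
multiple of `u` is a `ℤ`-combination of `ch₂^cris` of FORMALLY LIFTABLE modules on `W₀`) and Grothendieck existence for formal vector bundles — the
EXISTING crux `PadicSemiregularLift.FormalVectorBundlesAlgebraize` (stmt-HodgeConjecture-14106) taken BY NAME as a hypothesis of `_of` — through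
the landed sibling engine `…InnerFormInvariantSeeds.Engine.bo_mem_span_of_formalSeedClasses` (`twinPVHC_of_formalSeeds`).  The converse holds in
print (Chern-character isomorphism + resolution on the regular `𝒲` + `bo` bijective), so no content is lost or added.

r2 (wave-1 integration): `stub_polarisedCmNormPeriod` LANDED (p109597) and `stub_cmTwinAnchor` LANDED (p109741) — the CM TWIN ANCHOR on every
polarised twin family `D_h` is now a THEOREM of the tree (imported, `polarisedCmNormPeriod_holds`, `cmTwinAnchor_holds`); `stub_facts` SHRINKS to
three conjuncts (`DeRham[]` is the theorem `exists_deRhamIsoFamily_holds`: `lineFacts_of_openFacts`); the planner's `stub_ordinaryTwinModel` and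
`stub_discSpread` were MISSTATED as a pair (wave-1 worker: hypothesis (ii) consumes twin models, but a model at another period can be neither
built nor certified from the anchor's OPAQUE model — `IsGenuine` certifies only the model's own comparison package) and are RESHAPED into
`stub_divisorialDiscModels` (the model stub now OWNS the `p`-adic disc step and outputs genuine ordinary models with rational algebraic `u` on a set
of periods with NON-MEAGRE trace on `D_h`; XL formal, carrier-blocked: no `CrystallineRealization` value, no `W(k)`-models, no universal family)
and the twin-model-free `stub_discSpread` (good on a non-meagre subset of `D_h` ⟹ good on `D_h`; XL formal, definition-gap-blocked like the
sibling line's `TwinSpread`).  Registered stubs (4, after r3/r4): `stub_facts`, `stub_divisorialDiscModels`, `stub_twinFormalSeeds` [lead], `stub_discSpread` (+ in the interim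
file r3i the two LANDED anchor stubs as sorried copies).

r1: FACT POLICY (route-choice RCHOICE-K3PeriodSurjective, 09:18Z): period surjectivity is consumed BY NAME as the route crux
`Theses.NikulinTwinTransport.K3PeriodSurjective` (stmt-HodgeConjecture-15154) and Buskin's theorem BY NAME as the route item
`HodgeIsometryAlgebraic` (stmt-HodgeConjecture-13675) — both hypotheses of `TwinTwistorTransport_of`, not stubs; `Huybrechts_K3_hodgeTypes_H2` is
DISCHARGED (`_holds`); `CorrComp[]` is DERIVED from `cupProduct_mem_algebraicClasses_tripleProduct_surfaces` (`corrComp_of_cupAlg`);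
`stub_periodInvariance` is LANDED (p95441); `stub_cmNormAnchor` was SPLIT into lattice + geometry (both landed in wave 1), its clause `OverQbar`
dropped (descent is unnecessary — spreading over a f.g. `ℤ`-algebra, inside the model stub); THE HEART `stub_twinPVHC` gained the hypotheses the
composition owns (`Latt`, the marked projective `M`-twin pair) and the honesty lemma `twinPVHC_of_hodgeConjectureFor` (heart ⇐ HC(S × S′)).
# Line `ordinary-prime-anchors` — crux `NikulinTwinTransport.TwinTwistorTransport` (stmt-HodgeConjecture-14393)

Checked skeleton (crux-plan, planner-cruxplan-stmt-HodgeConjecture-14393-ordinary-prime-ancho-0, 2026-08-16) of the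
ARITHMETIC ROAD for the transport crux, from the triaged crux idea
`Cruxes/TwinTwistorTransport/Ideas/ordinary-prime-anchors.md` (panel r1: 2/2 pass) with the panel's sharpenings
(TRIAGE-r1-1 §ordinary-prime-anchors (1)–(5), G1–G3, A1–A2; TRIAGE-r1-2 §ordinary-prime-anchors (1)–(3)) and the
recommended MERGE with `nikulin-disc-adjacency-bek` (same lever family: characteristic-`p` anchor + Bloch–Esnault–Kerz
class lift + `p`-adic OBJECT lift on one `K3 × K3 / W` + propagation from a `ℚ̄`-generic lift).

THE CRUX (typed, rev 7, output level): every projective K3 surface `S` has a projective K3 partner `S″` and an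
ALGEBRAIC `ℂ`-linear equivalence `Ψ : H²(S″) ≃ H²(S)` whose inverse is rational, type-preserving and halves the
cup form.  By the LANDED reduction `Theorems.NikulinTwinTransport.twinTwistorTransport_of_twinTransport` (p85563)
it follows from the three K3 facts and `TwinTransportFor[M]` for ONE rational lattice `2`-similitude `M` with
rational inverse (`exists_twoSimilitude_k3Lattice`), so this line — like every line on this crux — delivers
`TwinTransportFor[M]` (`twinTransport_of`) and concludes the route declaration BY NAME (`TwinTwistorTransport_of`,
`TwinTwistorTransport_skeleton`).

THE LINE (road (a), registered).  Anchors UNDER the twin family instead of elsewhere in moduli: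
* `stub_cmNormAnchor` (char 0, known modulo Buskin + CM-square HC + Witt + Künneth): on every `h`-polarised
  `M`-twin family there is a CM twin pair `(S₁, S₁″)` whose CM field `E` has `2 ∈ N_{E/E⁺}(E^×)` — e.g. `E ∋ √−1`,
  or the CANONICAL-LIFT PAIR of the ordinary reduction of any twin pair under the norm condition (N_𝔭) of the card —
  and there the twin similitude is `e ∘ u` (`u` a Hodge ISOMETRY, algebraic by Buskin; `e ∈ E` algebraic by HC for
  CM squares) plus divisor corrections: ALGEBRAIC, and defined over `ℚ̄` (triage G3 / A1: "every ordinary anchor with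
  (N) is a disc-adjacency anchor"; honours `Negative.no_isometric_twin_of_odd`: isometries are only used between the
  two CM surfaces, whose transcendental rank is even, never on `S` itself).
* `stub_ordinaryTwinModel` ((A0) + specialisation of cycles AT THE ANCHOR, known modulo the classical crystalline
  package): the anchor pair has, for arbitrarily large `p`, a GENUINE ORDINARY `p`-ADIC TWIN MODEL — a smooth
  projective model `𝒲 / W(𝔽̄_p)` of `S₁ × S₁″` (Bogomolov–Zarhin: ordinary reduction in density one), the classical
  crystalline realization with Berthelot–Ogus comparison and period isomorphism, the de Rham twin class `γ_dR` over the
  UNRAMIFIED `K = W[1/p]` (the class is algebraic at the anchor, so this is free — no motivated-cycle input), and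
  `u = sp(γ) ∈ H⁴_cris(W₀)_K` a RATIONAL algebraic class (specialisation of the anchor cycle, Fulton §20.3).
* `stub_twinPVHC` (THE HEART, (A3) of the card = the `p`-adic variational Hodge statement for the twin class on an
  ordinary `K3 × K3 / W`): on a genuine ordinary twin model, if `sp(γ)` is a RATIONAL algebraic class then `γ_dR` is a
  `K`-combination of algebraic de Rham classes of the generic fibre.  Mechanism: Bloch–Esnault–Kerz Thm 1.3 (tree
  predicate `BlochEsnaultKerzLifting`, `p > 10`; condition (a) holds because `γ` is Hodge on the lift) lifts the
  `K₀ ⊗ ℚ`-class of a carrier for free; (⋆) CLASS-LIFTS-IMPLY-OBJECT-LIFTS for ONE carrier on the ordinary special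
  fibre (route PadicSemiregularLift, `FormalLiftingFromClassLifting` stmt-13825 — whose typed `d ≤ 3 ∨ Ω¹ free` clause
  EXCLUDES `d = 4`: the all-Hodge-torsion-free variant is what this stub needs, triage A2); Grothendieck existence
  (`FormalVectorBundlesAlgebraize`, stmt-14106); `ch₂` of the algebraised bundle.  Ordinarity (unit-root splitting,
  canonical coordinates, the CM canonical lift INSIDE the disc) is the extra structure offered to the object search.
* `stub_discSpread` (disc adjacency, known in print modulo bookkeeping): every `W(𝔽̄_p)`-point `t` of the anchor's
  residue disc lying on the twin family carries a genuine ordinary twin model with the SAME special fibre and the SAME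
  rational `u` (Berthelot–Ogus: horizontal = constant crystalline class; Deligne's Principle B: the horizontal transport
  of the anchor class IS the twin class at `t`), so generic goodness (the conclusion shape of `stub_twinPVHC`) makes the
  twin similitude algebraic at every such `t`; `p`-adic Baire gives such a `t` that is `ℚ̄`-GENERIC on the irreducible
  polarised twin family, and algebraicity propagates from a `ℚ̄`-generic point to every complex point (specialisation
  of cycles; the typed support `PadicSemiregularLift.HodgeLocusPropagation`, stmt-14977) — answering the panel's SCOPE
  objection (the crux is over `ℂ`, not `ℚ̄`).
* `stub_periodInvariance` (re-marking by Buskin; provable now) — VERBATIM the statement of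
  `Lines/semiregular-twin-hodge-locus.lean` Stub 4, so one proof serves both lines.
* `stub_facts` — the named inputs: the three Huybrechts K3 facts, composition of correspondences, Buskin's theorem
  (route support `HodgeIsometryAlgebraic` = tree fact verbatim), HC for CM squares (tree fact
  `Buskin2019_hodgeConjectureFor_square_of_CM`).

ROAD (b) (the card's ORIGINAL road, NOT registered; sorry-free alternative composition `twinTransport_of_roadB`):
reduce the GIVEN pair at an ordinary prime (`GivenPairOrdinaryModel`, (A0) over finitely generated fields + André's
motivated-cycle descent of `γ_dR`), RATIONAL SPECIALISATION (`GivenPairRationalSpecialisation`, statement (A2) of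
the card = Deligne 1982 Open Question 2.4 / André 1996 Problème 9.3 for this class; conjecture-grade, implied by HC),
then `stub_twinPVHC` on the given pair — no anchor, no spreading, no re-marking.  Both triagers judged (A2) avoidable;
it is kept typed so the lead can switch roads (`twinTransport_of_roadB` is kernel-checked below).

Disproof.lean (cdisprove cycle 1, NO KILL) honoured: (R),(T),(H) for `Ψ⁻¹` are discharged inside
`anchorAt_of_twinTransport` from rationality of `N` (T1/T1′: no `ℂ`-scaling anywhere — every class produced is the
period of a `K`-rational ALGEBRAIC de Rham class); `S″` is the `M`-twin from period surjectivity, never `S` (T3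
`Negative.no_self_twoSimilitude_of_odd`); isometries (Buskin) occur only between CM surfaces of even transcendental
rank (`Negative.no_isometric_twin_of_odd`); the multiplier is carried by `hM2` (T7); the hyperkähler negatives
(GenericFirstLine, NikulinParity, PolystableCrossTerm, AnchorConeCondition) are not engaged — no twistor line, cone or
sheaf on a non-projective fibre occurs.  The three `Negative.*` modules are imported so this check runs against them.
-/

noncomputable section

set_option linter.dupNamespace false

namespace Summit.HodgeConjecture.HodgeConjecture.Cruxes.TwinTwistorTransport.OrdinaryPrimeAnchors

open CategoryTheory MonoidalCategory
open scoped Manifold Isocrystal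
open Literature.AlgebraicGeometry.Motives Literature.AlgebraicGeometry.HodgeTheory
open Literature.AlgebraicGeometry.Surfaces
open Literature.AlgebraicTopology.SingularHomology
open Literature.AlgebraicGeometry.Crystalline
open Summit.HodgeConjecture.HodgeConjecture.Theses.NikulinTwinTransport
open Summit.HodgeConjecture.HodgeConjecture.Theorems.NikulinTwinTransport

/-! ## Notation block A — verbatim from `Theorems/NikulinTwinTransportTwinSimilitudeAlgebraicTransfer` -/

local notation3 (prettyPrint := false) "MarkedK3[" S ", " η ", " p ", " x "]" =>
  (IsIntegralClass p ∧
    (∀ q : complexBetti S (2 * 2), IsIntegralClass q → ∃ n : ℤ, q = n • p) ∧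
    (∀ c : complexBetti S (2 * 1), IsIntegralClass c ↔ ∃ v : K3Index → ℤ, η c = fun i => (v i : ℂ)) ∧
    (∀ a b : complexBetti S (2 * 1),
        cupProduct (rfl : 2 * 1 + 2 * 1 = 2 * 2) a b = k3Form (η a) (η b) • p) ∧
    IsOfHodgeType 2 S (2 * 1) 2 0 (LinearEquiv.symm η x) ∧
    (∀ τ : complexBetti S (2 * 1), IsOfHodgeType 2 S (2 * 1) 2 0 τ → ∃ t : ℂ, τ = t • LinearEquiv.symm η x))

local notation3 (prettyPrint := false) "PeriodPt[" x "]" =>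
  (k3Form x x = 0 ∧ 0 < (k3Form (star x) x).re ∧
    ∃ u : K3Index → ℤ, k3Form (fun i => (u i : ℂ)) x = 0 ∧ 0 < ∑ i, ∑ j, u i * k3Gram i j * u j)

local notation3 (prettyPrint := false) "Corr[" μ ", " S ", " S' ", " hS ", " hS' " ; " γ ", " y "]" =>
  complexGysin μ
    (IsSmoothProjective.tensor_holds (IsK3Surface.isSmoothProjective hS)
      (IsK3Surface.isSmoothProjective hS'))
    (IsK3Surface.isSmoothProjective hS) (SemiCartesianMonoidalCategory.fst S S')
    (rfl : 2 * 1 + 2 * 2 + 2 * 2 = 2 * 1 + 2 * (2 + 2))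
    (cupProduct (rfl : 2 * 1 + 2 * 2 = 2 * 1 + 2 * 2)
      (complexBetti.map (SemiCartesianMonoidalCategory.snd S S') (2 * 1) y) γ)

local notation3 (prettyPrint := false) "TwinTransportFor[" M "]" =>
  ∀ (μ : OrientationFamily), μ.HasPoincareDuality →
    ∀ (S S' : SchemeOver ℂ) (hS : IsK3Surface S) (hS' : IsK3Surface S')
      (η : complexBetti S (2 * 1) ≃ₗ[ℂ] (K3Index → ℂ)) (p : complexBetti S (2 * 2))
      (x : K3Index → ℂ)
      (η' : complexBetti S' (2 * 1) ≃ₗ[ℂ] (K3Index → ℂ)) (p' : complexBetti S' (2 * 2))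
      (x' : K3Index → ℂ),
      MarkedK3[S, η, p, x] → PeriodPt[x] → MarkedK3[S', η', p', x'] → PeriodPt[x'] →
      (∃ t : ℂ, M x' = t • x) →
      ∃ γ ∈ algebraicClasses (MonoidalCategoryStruct.tensorObj S S') 2,
        ∀ y : complexBetti S' (2 * 1), η.symm (M (η' y)) = Corr[μ, S, S', hS, hS' ; γ, y]

/-! ## Notation block B — verbatim from `Lines/semiregular-twin-hodge-locus.lean` (shared with that line) -/

/-- `Latt[M, N]`: `M` is a rational `2`-similitude of `(Λ_ℂ, k3Form)` with rational two-sided inverse `N`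
(verbatim the conclusion of `exists_twoSimilitude_k3Lattice`). -/
local notation3 (prettyPrint := false) "Latt[" M ", " N "]" =>
  ((∀ v : K3Index → ℤ, ∃ w : K3Index → ℚ, M (fun i => (v i : ℂ)) = fun i => (w i : ℂ)) ∧
    (∀ v : K3Index → ℤ, ∃ w : K3Index → ℚ, N (fun i => (v i : ℂ)) = fun i => (w i : ℂ)) ∧
    M * N = 1 ∧ N * M = 1 ∧
    (∀ a b, k3Form (M a) (M b) = 2 * k3Form a b))

/-- `PolPeriod[h, x]`: `x` is a period point polarised by the lattice vector `h` (the points of `D_h = D ∩ h^⊥`). -/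
local notation3 (prettyPrint := false) "PolPeriod[" h ", " x "]" =>
  (k3Form x x = 0 ∧ 0 < (k3Form (star x) x).re ∧ k3Form (fun i => ((h : K3Index → ℤ) i : ℂ)) x = 0)

/-- `Good[M, μ, S, S', hS, hS', η, η']`: the twin similitude `η⁻¹ ∘ M ∘ η'` is induced by an algebraic class. -/
local notation3 (prettyPrint := false) "Good[" M ", " μ ", " S ", " S' ", " hS ", " hS' ", " η ", " η' "]" =>
  ∃ γ ∈ algebraicClasses (MonoidalCategoryStruct.tensorObj S S') 2,
    ∀ y : complexBetti S' (2 * 1), (η : complexBetti S (2 * 1) ≃ₗ[ℂ] (K3Index → ℂ)).symm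
      (M ((η' : complexBetti S' (2 * 1) ≃ₗ[ℂ] (K3Index → ℂ)) y)) = Corr[μ, S, S', hS, hS' ; γ, y]

/-- `GoodPairAt[M, μ, x]`: SOME marked projective `M`-twin pair with first period `x` has an algebraic twin similitude. -/
local notation3 (prettyPrint := false) "GoodPairAt[" M ", " μ ", " x "]" =>
  ∃ (S S' : SchemeOver ℂ) (hS : IsK3Surface S) (hS' : IsK3Surface S')
    (η : complexBetti S (2 * 1) ≃ₗ[ℂ] (K3Index → ℂ)) (p : complexBetti S (2 * 2))
    (η' : complexBetti S' (2 * 1) ≃ₗ[ℂ] (K3Index → ℂ)) (p' : complexBetti S' (2 * 2))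
    (x' : K3Index → ℂ),
    MarkedK3[S, η, p, x] ∧ PeriodPt[x] ∧ MarkedK3[S', η', p', x'] ∧ PeriodPt[x'] ∧
    (∃ t : ℂ, M x' = t • x) ∧ Good[M, μ, S, S', hS, hS', η, η']

/-- `CorrComp[]`: composition of algebraic correspondences between K3 surfaces is induced by an algebraic class
(verbatim the hypothesis `hcomp` of `twinSimilitudeAlgebraic_of_twinTransport`; Buskin Lemma 6.3 / Fulton Prop. 16.1.1). -/
local notation3 (prettyPrint := false) "CorrComp[]" =>
  ∀ (μ : OrientationFamily), μ.HasPoincareDuality →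
    ∀ (S S' S'' : SchemeOver ℂ) (hS : IsK3Surface S) (hS' : IsK3Surface S') (hS'' : IsK3Surface S''),
    ∀ γ ∈ algebraicClasses (MonoidalCategoryStruct.tensorObj S S') 2,
    ∀ γ' ∈ algebraicClasses (MonoidalCategoryStruct.tensorObj S' S'') 2,
    ∃ γ'' ∈ algebraicClasses (MonoidalCategoryStruct.tensorObj S S'') 2,
      ∀ y : complexBetti S'' (2 * 1),
        Corr[μ, S, S'', hS, hS'' ; γ'', y] = Corr[μ, S, S', hS, hS' ; γ, Corr[μ, S', S'', hS', hS'' ; γ', y]]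

/-! ## Notation block C — this line -/

/-- `RatEnd[J]`: the endomorphism `J` of `Λ_ℂ` is defined over `ℚ` (verbatim from `Theorems…CmNormDense`). -/
local notation3 (prettyPrint := false) "RatEnd[" J "]" =>
  ∀ v : K3Index → ℤ, ∃ w : K3Index → ℚ, J (fun i => (v i : ℂ)) = fun i => (w i : ℂ)

/-- `CMNormPeriod[c, x]`: `x` is a CM-norm period of multiplier `c` — an eigen-period, with NON-REAL eigenvalue, of a
rational `c`-similitude `J` of `(Λ_ℂ, k3Form)` with rational two-sided inverse `K` (verbatim the notation of
`Theorems/NikulinTwinTransportHodgeSimilitudeAlgebraicCmNormDense.lean`, whose `exists_cmNormPeriod 2` is the seed). -/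
local notation3 (prettyPrint := false) "CMNormPeriod[" c ", " x "]" =>
  ∃ (J K : Module.End ℂ (K3Index → ℂ)), RatEnd[J] ∧ RatEnd[K] ∧ J * K = 1 ∧ K * J = 1 ∧
    (∀ a b, k3Form (J a) (J b) = c * k3Form a b) ∧ ∃ t : ℂ, t.im ≠ 0 ∧ J x = t • x

/-- `DeRham[]`: de Rham's theorem in multiplicative form for every finite-dimensional complex model space (the tree's
named fact `Literature.NumberTheory.Transcendental.exists_deRhamIsoFamily`; the only source of the bigrading of the
cup product on the fourfold `S ⊗ S`, consumed by the anchor theorem `CmNormAnchors.stub_cmSelfSimilitude_algebraic`). -/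
local notation3 (prettyPrint := false) "DeRham[]" =>
  ∀ (E : Type) [NormedAddCommGroup E] [NormedSpace ℂ E] [FiniteDimensional ℂ E],
    Literature.NumberTheory.Transcendental.exists_deRhamIsoFamily 𝓘(ℝ, E)

/-- `LineFacts[]` (reshape r1 of the planner's `K3Facts[]`): the named LITERATURE inputs of the line still unproved, as
one conjunction — existence of markings (`Huybrechts_K3_marking_exists`), cup products of algebraic classes on triple
products of surfaces (`cupProduct_mem_algebraicClasses_tripleProduct_surfaces`, which gives `CorrComp[]` by the tree's
`corrComp_surfaces_of_cup'`), the Hodge conjecture for squares of CM K3 surfaces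
(`Buskin2019_hodgeConjectureFor_square_of_CM`) and de Rham's theorem (`DeRham[]`).  Period surjectivity and Buskin's theorem
are NOT here: they are the route items `K3PeriodSurjective` (15154) and `HodgeIsometryAlgebraic` (13675), hypotheses of the
composition BY NAME (route fact policy); `Huybrechts_K3_hodgeTypes_H2` is a theorem (`_holds`). -/
local notation3 (prettyPrint := false) "LineFacts[]" =>
  (Huybrechts_K3_marking_exists ∧ cupProduct_mem_algebraicClasses_tripleProduct_surfaces ∧
    Buskin2019_hodgeConjectureFor_square_of_CM ∧ DeRham[])

/-! ## The `p`-adic twin model (posited INTERFACE, in the style of `Literature…Crystalline.PadicAnchor.Anchor`;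
to be vendored as a sorry-free definitions layer before stubs 3–5 land as Theorems) -/

/-- A **`p`-adic twin model** of the marked pair `(S, η; S', η')` for the lattice similitude `M` (real carriers
only; which values are meant is recorded by `TwinModel.IsGenuine` / `TwinModel.IsOrdinary`): a prime `p > 10`
(Bloch–Esnault–Kerz bound `d + 6 < p`, `d = 4`), an algebraically closed residue field `k` (intended `𝔽̄_p`), a smooth
proper model `𝒲 / W(k)` of relative dimension `4`, projective over `W(k)`, a crystalline realization `C` over `k`, an
embedding `ι : K = W(k)[1/p] → ℂ` with `S × S' ≅ W_K ⊗_ι ℂ`, the period comparison `cmp`, the BETTI TWIN CLASS `γB`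
(a Künneth class of the twin similitude: `[γB]_* = η⁻¹ ∘ M ∘ η'`), its de Rham descent `γdR ∈ F² H⁴_dR(W_K/K)` to the
UNRAMIFIED field `K`, and its crystalline specialisation `u = bo⁻¹(γdR) ∈ H⁴_cris(W₀/W)_K`. -/
structure TwinModel (μ : OrientationFamily) (S S' : SchemeOver ℂ) (hS : IsK3Surface S) (hS' : IsK3Surface S')
    (η : complexBetti S (2 * 1) ≃ₗ[ℂ] (K3Index → ℂ)) (η' : complexBetti S' (2 * 1) ≃ₗ[ℂ] (K3Index → ℂ))
    (M : Module.End ℂ (K3Index → ℂ)) where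
  /-- the residue characteristic -/
  p : ℕ
  [prime : Fact p.Prime]
  /-- the Bloch–Esnault–Kerz bound `4 + 6 < p` -/
  large : 4 + 6 < p
  /-- the residue field (intended `𝔽̄_p`) -/
  k : Type
  [field : Field k]
  [charP : CharP k p]
  [perfect : PerfectRing k p]
  [algClosed : IsAlgClosed k]
  /-- the model of `S × S'` over `W(k)` -/
  𝒲 : SchemeOver (WittVector p k)
  /-- `𝒲 / W(k)` is a smooth proper model of relative dimension `4` -/
  model : WittScheme.IsSmoothProperModel 4 𝒲
  /-- `𝒲` is projective over the ring `W(k)` -/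
  projective : IsProjectiveOverRing 𝒲
  /-- crystalline realization over `k` (intended: the classical one) -/
  C : CrystallineRealization p k
  /-- the complex embedding of `K = W(k)[1/p]` -/
  ι : K(p, k) →+* ℂ
  /-- `S × S' ≅ W_K ⊗_{K,ι} ℂ` -/
  iso : Nonempty (MonoidalCategoryStruct.tensorObj S S' ≅ (baseChangeHom ι).obj (WittScheme.genericFibre 𝒲))
  /-- period comparison (Grothendieck's algebraic de Rham theorem + GAGA + base change along `ι` + `iso`) -/
  cmp : ∀ i : ℕ, C.dR.obj (WittScheme.genericFibre 𝒲) i →ₛₗ[ι] complexBetti (MonoidalCategoryStruct.tensorObj S S') i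
  /-- the Betti twin class -/
  γB : complexBetti (MonoidalCategoryStruct.tensorObj S S') (2 * 2)
  /-- `γB` acts on `H²` as the twin similitude `η⁻¹ ∘ M ∘ η'` -/
  act : ∀ y : complexBetti S' (2 * 1), η.symm (M (η' y)) = Corr[μ, S, S', hS, hS' ; γB, y]
  /-- the de Rham twin class over `K` -/
  γdR : C.dR.obj (WittScheme.genericFibre 𝒲) (2 * 2)
  /-- its period is the Betti twin class -/
  cmp_γdR : cmp (2 * 2) γdR = γB
  /-- it lies in `F² H⁴_dR(W_K/K)` -/
  fil_γdR : γdR ∈ C.dR.fil (2 * 2) 2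
  /-- the crystalline specialisation `sp(γ)` -/
  u : C.obj (WittScheme.specialFibre 𝒲) (2 * 2)
  /-- `bo (sp γ) = γ_dR` -/
  bo_u : C.bo 𝒲 (2 * 2) u = γdR

attribute [instance] TwinModel.prime TwinModel.field TwinModel.charP TwinModel.perfect TwinModel.algClosed

namespace TwinModel

variable {μ : OrientationFamily} {S S' : SchemeOver ℂ} {hS : IsK3Surface S} {hS' : IsK3Surface S'}
  {η : complexBetti S (2 * 1) ≃ₗ[ℂ] (K3Index → ℂ)} {η' : complexBetti S' (2 * 1) ≃ₗ[ℂ] (K3Index → ℂ)}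
  {M : Module.End ℂ (K3Index → ℂ)}

/-- **ORDINARITY** of the special fibre, typed on the real carrier `H²_cris(W₀/W)_K` with its Frobenius: there are two
`K`-independent Frobenius-FIXED vectors (unit-root rank `≥ 2`).  For `W₀ = S₀ × S₀″` a product of K3 surfaces over
`k = k̄` (`b₁ = 0`, so `H²(W₀) = H²(S₀) ⊕ H²(S₀″)`), each factor contributes unit-root rank `1` iff it is ORDINARY
(height `1`) and `0` otherwise (Dieudonné–Manin; slope-`0` isocrystals over `k̄` are spanned by fixed vectors), so this
says: both K3 factors are ordinary — canonical lifts, Serre–Tate/canonical coordinates (Nygaard 1983, Deligne–Illusie)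
are then available on the disc. -/
def IsOrdinary (D : TwinModel μ S S' hS hS' η η' M) : Prop :=
  ∃ v w : D.C.obj (WittScheme.specialFibre D.𝒲) 2,
    LinearIndependent K(D.p, D.k) ![v, w] ∧
      D.C.frobK (WittScheme.specialFibre D.𝒲) 2 v = v ∧ D.C.frobK (WittScheme.specialFibre D.𝒲) 2 w = w

/-- **GENUINENESS** of a twin model: the classical facts about (class, model, crystalline and de Rham realizations,
Berthelot–Ogus map, period comparison) that the line consumes — named-fact pattern, theorems in print for the
CLASSICAL package: the twin class is a rational Hodge class; the period isomorphism; compatibility of `cmp` with cycle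
classes (cycle classes of `W_K` are algebraic on `S × S'`) and with the Hodge filtration (the converse direction
"a `K`-rational de Rham class with algebraic period is a `K`-combination of classes of `K`-cycles" is NOT a theorem — Galois
may act non-trivially on the cycle classes of `W_{K̄}`, cf. the residual predicate `PadicAnchor.Anchor.CycleDescent` — and is
carried separately as `TwinModel.CycleDescent`, never assumed here); specialisation of cycles; Berthelot–Ogus 3.8; Bloch–Esnault–Kerz 1.3; `p`-torsion-freeness of `H^b(𝒲, 𝒪)`
and `H^b(𝒲, Ω¹)` (Deligne–Illusie + Künneth for a product of K3 surfaces, `p ≥ 5`; `Ω²` has no carrier in the tree yet —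
triage A2: the `d = 4` variant of `FormalLiftingFromClassLifting` needs all `H^b(Ω^a)` torsion-free). -/
structure IsGenuine (D : TwinModel μ S S' hS hS' η η' M) : Prop where
  /-- the twin class is rational … -/
  rational : IsRationalClass D.γB
  /-- … of Hodge type `(2,2)` -/
  hodgeType : IsOfHodgeType 4 (MonoidalCategoryStruct.tensorObj S S') (2 * 2) 2 2 D.γB
  /-- period isomorphism, spanning half -/
  periodSpan : ∀ i : ℕ, Submodule.span ℂ (Set.range (D.cmp i)) = ⊤
  /-- … and injectivity -/
  periodInjective : ∀ i : ℕ, Function.Injective (D.cmp i)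
  /-- cycle classes: the period of a rational algebraic de Rham class of `W_K` is algebraic on `S × S'` -/
  cycleCompatible : ∀ (r : ℕ) (x : D.C.dR.obj (WittScheme.genericFibre D.𝒲) (2 * r)),
    x ∈ D.C.dR.ratAlgebraicClasses (WittScheme.genericFibre D.𝒲) r →
      D.cmp (2 * r) x ∈ algebraicClasses (MonoidalCategoryStruct.tensorObj S S') r
  /-- Hodge filtration: `cmp (Fʳ H²ʳ_dR) ⊆ Fʳ H²ʳ_B` -/
  filCompatible : ∀ (r : ℕ) (x : D.C.dR.obj (WittScheme.genericFibre D.𝒲) (2 * r)),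
    x ∈ D.C.dR.fil (2 * r) r → D.cmp (2 * r) x ∈ PadicAnchor.bettiHodgeFil 4 (MonoidalCategoryStruct.tensorObj S S') r
  /-- specialisation of cycles (Fulton §20.3 + Gillet–Messing) at `D.C` -/
  specialization : PadicAnchor.SpecializationOfCycles D.C
  /-- Berthelot–Ogus 1983, Thm. 3.8 at `D.C` -/
  lineBundles : D.C.BerthelotOgusLineBundleLifting
  /-- Bloch–Esnault–Kerz 2014, Thm. 1.3 at `D.C` -/
  bek : BlochEsnaultKerzLifting D.C
  /-- `H^b(𝒲, 𝒪)` has no `p`-torsion -/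
  torsionFree_structureSheaf :
    ∀ (b : ℕ) (x : structureSheafCohomology D.𝒲.left b), (D.p : ℤ) • x = 0 → x = 0
  /-- `H^b(𝒲, Ω¹)` has no `p`-torsion -/
  torsionFree_hodgeOne : ∀ (b : ℕ) (x : hodgeCohomologyOne D.𝒲 b), (D.p : ℤ) • x = 0 → x = 0


/-- **CYCLE DESCENT at the twin model `D`** (the RESIDUAL predicate, exactly like `PadicAnchor.Anchor.CycleDescent`; NOT a field of
`IsGenuine` and not a theorem for the classical package in general — with `L/K` finite Galois acting non-trivially on the cycle classes of
`W_L`, a `K`-rational class in their `L`-span need not lie in the `K`-span of classes of `K`-cycles): every `K`-rational de Rham class of `W_K`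
whose period is algebraic on `S × S'` is a `K`-combination of classes of `K`-cycles. Consumed only as an explicit hypothesis (honesty lemma
`heart ⇐ HC + CycleDescent`). -/
def CycleDescent (D : TwinModel μ S S' hS hS' η η' M) : Prop :=
  ∀ (r : ℕ) (x : D.C.dR.obj (WittScheme.genericFibre D.𝒲) (2 * r)),
    D.cmp (2 * r) x ∈ algebraicClasses (MonoidalCategoryStruct.tensorObj S S') r →
      x ∈ Submodule.span K(D.p, D.k)
        (D.C.dR.ratAlgebraicClasses (WittScheme.genericFibre D.𝒲) r :
          Set (D.C.dR.obj (WittScheme.genericFibre D.𝒲) (2 * r)))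

/-- **Glue (proved): algebraic over `K` ⟹ Good.**  On a genuine twin model, if the de Rham twin class is a
`K`-combination of cycle classes of `W_K`, then the twin similitude `η⁻¹ ∘ M ∘ η'` is induced by an algebraic class on
`S × S'` — namely by the Betti twin class `γB = cmp γdR` itself (semilinear span + `cycleCompatible`; `algebraicClasses`
is a `ℂ`-subspace).  This is the only place the output clause (A) of the crux is produced; (R),(T),(H) follow inside
`anchorAt_of_twinTransport`. -/
theorem good_of_mem_span (D : TwinModel μ S S' hS hS' η η' M) (hG : D.IsGenuine)
    (h : D.γdR ∈ Submodule.span K(D.p, D.k)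
      (D.C.dR.ratAlgebraicClasses (WittScheme.genericFibre D.𝒲) 2 :
        Set (D.C.dR.obj (WittScheme.genericFibre D.𝒲) (2 * 2)))) :
    Good[M, μ, S, S', hS, hS', η, η'] := by
  have h1 := PadicAnchor.semilinear_apply_mem_span_image (D.cmp (2 * 2)) h
  rw [D.cmp_γdR] at h1
  have h2 : Submodule.span ℂ (D.cmp (2 * 2) ''
      (D.C.dR.ratAlgebraicClasses (WittScheme.genericFibre D.𝒲) 2 :
        Set (D.C.dR.obj (WittScheme.genericFibre D.𝒲) (2 * 2)))) ≤
      algebraicClasses (MonoidalCategoryStruct.tensorObj S S') 2 := by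
    refine Submodule.span_le.2 ?_
    rintro _ ⟨x, hx, rfl⟩
    exact hG.cycleCompatible 2 x hx
  exact ⟨D.γB, h2 h1, D.act⟩

end TwinModel


/-! ## The stub statements (precise `Prop`s; the sorried `Stub.stub_*` theorems below are the REGISTERED stubs) -/

/-- `OpenFacts[]` (reshape r2): the THREE named Literature inputs still without a discharge —
`Huybrechts_K3_marking_exists` (XL: b₂ = 22, evenness, index −16), `cupProduct_mem_algebraicClasses_tripleProduct_surfaces`
(L–XL: Chow moving on sixfolds), `Buskin2019_hodgeConjectureFor_square_of_CM` (XL, needs Buskin = route item 13675).  `DeRham[]` left the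
list: it is the theorem `exists_deRhamIsoFamily_holds` (wave-1 worker, `lineFacts_of_openFacts`). -/
local notation3 (prettyPrint := false) "OpenFacts[]" =>
  (Huybrechts_K3_marking_exists ∧ cupProduct_mem_algebraicClasses_tripleProduct_surfaces ∧
    Buskin2019_hodgeConjectureFor_square_of_CM)

/-- `ModelAt[M, μ, z]` (reshape r2/r4): SOME marked projective `M`-twin pair with first period `z` carries a genuine `p`-adic twin model whose
special fibre `W₀` is DIVISORIAL — rational divisor classes are Chern classes of line bundles and every rational algebraic class is a polynomial
in them (`PadicAnchor.DivisorClassesAreChern`, `PadicAnchor.RationallyLefschetz`; in print: SUPERSINGULAR reduction of both K3 factors, Tate for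
supersingular K3 surfaces + Künneth) — and whose crystalline specialisation `u = sp(γ)` is a RATIONAL algebraic class of `W₀` (the input shape of
the heart). r4 replaces the idle `IsOrdinary` of r1–r3 by these two predicates. -/
local notation3 (prettyPrint := false) "ModelAt[" M ", " μ ", " z "]" =>
  ∃ (S S' : SchemeOver ℂ) (hS : IsK3Surface S) (hS' : IsK3Surface S')
    (η : complexBetti S (2 * 1) ≃ₗ[ℂ] (K3Index → ℂ)) (p : complexBetti S (2 * 2))
    (η' : complexBetti S' (2 * 1) ≃ₗ[ℂ] (K3Index → ℂ)) (p' : complexBetti S' (2 * 2))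
    (x' : K3Index → ℂ),
    MarkedK3[S, η, p, z] ∧ PeriodPt[z] ∧ MarkedK3[S', η', p', x'] ∧ PeriodPt[x'] ∧ (∃ t : ℂ, M x' = t • z) ∧
    ∃ D : TwinModel μ S S' hS hS' η η' M,
      D.IsGenuine ∧ PadicAnchor.DivisorClassesAreChern D.C (WittScheme.specialFibre D.𝒲) ∧
        PadicAnchor.RationallyLefschetz D.C (WittScheme.specialFibre D.𝒲) ∧
        D.u ∈ D.C.ratAlgebraicClasses (WittScheme.specialFibre D.𝒲) 2

/-- `NonMeagre[h, T]`: the trace of `T ⊆ Λ_ℂ` on the polarised period domain `D_h = {x | PolPeriod[h, x]}` is NOT meagre in `D_h`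
(subspace topology; `D_h` is locally compact, hence Baire — wave-1 worker, `baireSpace_polPeriod`). -/
local notation3 (prettyPrint := false) "NonMeagre[" h ", " T "]" =>
  ¬ IsMeagre ((Subtype.val : {x : K3Index → ℂ //
      (k3Form x x = 0 ∧ 0 < (k3Form (star x) x).re ∧ k3Form (fun i => ((h : K3Index → ℤ) i : ℂ)) x = 0)} →
    (K3Index → ℂ)) ⁻¹' (T : Set (K3Index → ℂ)))

/-- **Stub 1 · stub_facts** (reshape r2: the three named LITERATURE inputs still unproved; expected stub-blocked on the facts).
See `OpenFacts[]`. -/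
def stub_facts : Prop := OpenFacts[]

/-- **Stub 3′ · stub_divisorialDiscModels** (reshape r4: the models' special fibres are DIVISORIAL — supersingular primes of the CM anchor — instead of
ordinary; reshape r2 = the planner's `stub_ordinaryTwinModel` with the `p`-adic DISC STEP of the old
`stub_discSpread` moved upstream into it, as the wave-1 analysis requires: producer and consumer of every twin model must be the SAME pair,
because `IsGenuine` certifies the comparison package only for the model's own `(𝒲, ι, cmp)` and nothing can be certified for an opaque `C`
at another period; standard in print, formal XL, blocked on carriers).  For the lattice datum, the route items, the facts and a polarisation
`h`: a GOOD `h`-polarised marked `M`-twin ANCHOR pair whose first surface has complex multiplication (the output of the LANDED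
`stub_polarisedCmNormPeriod` + `stub_cmTwinAnchor`) yields a set `T ⊆ Λ_ℂ` with NON-MEAGRE trace on `D_h` at every point of which some marked
`M`-twin pair carries a genuine twin model with DIVISORIAL special fibre and rational algebraic `u` (`ModelAt`).  Proof in print (with SUPERSINGULAR
in place of ordinary reduction: a CM K3 surface reduces supersingularly at the primes inert in its CM field, density `1/2`; Tate for supersingular K3
surfaces — Charles 2013, Madapusi Pera 2015, Maulik 2014 — with `ρ = 22` and Künneth makes `W₀ = S₀ × S₀'` divisorial, and `cl(D) = c₁(𝒪(D))`
is Gros 1985 / Gillet–Messing 1987): spread `S₁ × S₁'` and a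
RATIONALISED algebraic twin cycle `Z` (Good + markings + `Latt`: the rational Künneth solution of `[·]_* = η₁⁻¹Mη₁'`) over a smooth f.g.
`ℤ`-algebra `A ⊂ ℂ`; good SUPERSINGULAR reduction of both (isogenous) factors at the inert primes of a number-field point of `Spec A`, `p > 10` cofinitely; injective Hensel lift `A ↪ W(𝔽̄_p)`; the universal `h`-quasi-polarised
`M`-twin family over a neat level cover `B̃_h` (Baily–Borel, Rizov 2006, Madapusi Pera 2015) with its smooth integral model at `p`; for EVERY
`W(𝔽̄_p)`-point `t` of the residue disc of the anchor the classical package (Berthelot–Ogus 2.4/2.5/3.8 — horizontal sections over the disc are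
constant crystalline classes, so the special fibre and `u = cl_cris(Z_k)` are those of the anchor — Gillet–Messing, Bloch–Esnault–Kerz 1.3,
Deligne–Illusie torsion-freeness + Künneth, Deligne's Principle B 2.12 for the de Rham component of the flat transport of the ALGEBRAIC anchor
class) is a genuine `TwinModel` with the same (divisorial) special fibre at `(S_t, S_t')` along ANY embedding `ι : K ↪ ℂ` extending `A ⊂ ℂ`-compatibly; `p`-adic Baire in the
complete disc `W(𝔽̄_p)^{19}` gives `t` over the generic point of `B̃_h`, and as `ι` varies `ι(t)` runs through ALL `ℚ̄`-generic complex points of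
the component — a CO-MEAGRE subset of `D_h^{±}` (the other component by complex conjugation); re-mark by `Γ̃` (twin class unchanged). -/
def stub_divisorialDiscModels : Prop :=
  ∀ (M N : Module.End ℂ (K3Index → ℂ)), Latt[M, N] →
    ∀ (μ : OrientationFamily), μ.HasPoincareDuality → K3PeriodSurjective → HodgeIsometryAlgebraic → LineFacts[] →
      ∀ (h : K3Index → ℤ), 0 < ∑ i, ∑ j, h i * k3Gram i j * h j →
        ∀ (S₁ S₁' : SchemeOver ℂ) (hS₁ : IsK3Surface S₁) (hS₁' : IsK3Surface S₁')
          (η₁ : complexBetti S₁ (2 * 1) ≃ₗ[ℂ] (K3Index → ℂ)) (p₁ : complexBetti S₁ (2 * 2)) (x₁ : K3Index → ℂ)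
          (η₁' : complexBetti S₁' (2 * 1) ≃ₗ[ℂ] (K3Index → ℂ)) (p₁' : complexBetti S₁' (2 * 2)) (x₁' : K3Index → ℂ),
          MarkedK3[S₁, η₁, p₁, x₁] → PolPeriod[h, x₁] → MarkedK3[S₁', η₁', p₁', x₁'] → PeriodPt[x₁'] →
          (∃ t : ℂ, M x₁' = t • x₁) → HasComplexMultiplication S₁ → Good[M, μ, S₁, S₁', hS₁, hS₁', η₁, η₁'] →
          ∃ T : Set (K3Index → ℂ), NonMeagre[h, T] ∧ ∀ z ∈ T, PolPeriod[h, z] → ModelAt[M, μ, z]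

/-- `HeartPVHC[M, μ, …]`-shape, written `TwinPVHC[]`: the planner's heart (A3) — the rational `p`-adic variational Hodge statement for the twin
class of a MARKED PROJECTIVE `M`-TWIN PAIR on a genuine ordinary twin model (`u = sp(γ)` rational algebraic on `W₀` ⟹ `γ_dR ∈ K · A²(W_K)`).
Since reshape r3 it is NO LONGER A STUB: it is DERIVED (`twinPVHC_of_formalSeeds`) from the smaller research stub `stub_twinFormalSeeds` and
Grothendieck existence for formal vector bundles, the route crux `PadicSemiregularLift.FormalVectorBundlesAlgebraize` (stmt-HodgeConjecture-14106)
taken BY NAME. -/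
local notation3 (prettyPrint := false) "TwinPVHC[]" =>
  ∀ (M N : Module.End ℂ (K3Index → ℂ)), Latt[M, N] →
    ∀ (μ : OrientationFamily), μ.HasPoincareDuality →
      ∀ (S₂ S₂' : SchemeOver ℂ) (hS₂ : IsK3Surface S₂) (hS₂' : IsK3Surface S₂')
        (η₂ : complexBetti S₂ (2 * 1) ≃ₗ[ℂ] (K3Index → ℂ)) (p₂ : complexBetti S₂ (2 * 2)) (x₂ : K3Index → ℂ)
        (η₂' : complexBetti S₂' (2 * 1) ≃ₗ[ℂ] (K3Index → ℂ)) (p₂' : complexBetti S₂' (2 * 2)) (x₂' : K3Index → ℂ),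
        MarkedK3[S₂, η₂, p₂, x₂] → PeriodPt[x₂] → MarkedK3[S₂', η₂', p₂', x₂'] → PeriodPt[x₂'] →
        (∃ t : ℂ, M x₂' = t • x₂) →
        ∀ D : TwinModel μ S₂ S₂' hS₂ hS₂' η₂ η₂' M, D.IsGenuine →
          PadicAnchor.DivisorClassesAreChern D.C (WittScheme.specialFibre D.𝒲) →
          PadicAnchor.RationallyLefschetz D.C (WittScheme.specialFibre D.𝒲) →
          D.u ∈ D.C.ratAlgebraicClasses (WittScheme.specialFibre D.𝒲) 2 →
          D.γdR ∈ Submodule.span K(D.p, D.k)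
            (D.C.dR.ratAlgebraicClasses (WittScheme.genericFibre D.𝒲) 2 :
              Set (D.C.dR.obj (WittScheme.genericFibre D.𝒲) (2 * 2)))

/-- `FormalSeeds[D]`: on the twin model `D`, a non-zero integer multiple of the specialised twin class `u = sp(γ)` is a `ℤ`-combination of
second crystalline Chern characters `ch₂^cris(E)` of modules `E` on the special fibre `W₀` that lift FORMALLY to the `p`-adic completion of `𝒲`
(`WittScheme.LiftsFormally`: a compatible system of vector bundles on the thickenings) — verbatim the hypothesis shape of the sibling engine
`bo_mem_span_of_formalSeedClasses` (route PadicSemiregularLift) at `r = 2`. -/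
local notation3 (prettyPrint := false) "FormalSeeds[" D "]" =>
  ∃ N : ℤ, N ≠ 0 ∧ N • TwinModel.u D ∈ AddSubgroup.closure
    {x | ∃ E : (WittScheme.specialFibre (TwinModel.𝒲 D)).left.Modules, WittScheme.LiftsFormally (TwinModel.𝒲 D) E ∧
      x = (TwinModel.C D).chCris (WittScheme.specialFibre (TwinModel.𝒲 D)) E 2}

/-- **Stub 4′ · stub_twinFormalSeeds** (THE RESEARCH HEART after reshapes r3/r4; open; hardest; lead).  On a genuine `p`-adic twin model of a marked
projective `M`-twin pair with DIVISORIAL special fibre `W₀ = (S × S')₀` (`DivisorClassesAreChern`, `RationallyLefschetz` — supersingular reduction; r4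
replaces the idle ordinarity hypothesis of r1–r3 by the one structure the object search can use: `u` is then, up to `N`, a `ℤ`-combination of
products `c₁(L) · c₁(L')` of Chern classes of LINE BUNDLES on `W₀`, so the candidate carriers are non-split deformations of sums of line bundles, the
seed problem of the sibling route PadicSemiregularLift at supersingular anchors) whose specialised twin class `u = sp(γ)` is a RATIONAL algebraic class,
`u` is — up to a non-zero integer — a `ℤ`-combination of `ch₂^cris` of FORMALLY LIFTABLE modules on `W₀` (`FormalSeeds[D]`).  TIGHT: with
Grothendieck existence (`FormalVectorBundlesAlgebraize`, 14106) it gives the planner's heart `TwinPVHC[]` (`twinPVHC_of_formalSeeds`, via the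
sibling engine `bo_mem_span_of_formalSeedClasses`: `bo(ch₂^cris(E|₀)) = ch₂^dR(E_K)` is algebraic), and conversely `TwinPVHC[]` gives it in print
(`γ_K = ch₂(ξ)`, `ξ ∈ K₀(W_K)_ℚ` by the Chern-character isomorphism, extend and resolve `ξ` by vector bundles on the regular scheme `𝒲`, restrict to
`W₀`, `bo` bijective) — so the research content of the line is EXACTLY this deformation statement, and the algebraization half is the existing
crux 14106.  Mechanism offered: Bloch–Esnault–Kerz Thm 1.3 (`IsGenuine.bek`: the `K₀ ⊗ ℚ` class of any carrier with the Hodge condition lifts to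
the pro-system for free, the condition holding because `γ` is Hodge on the lift) + (⋆) CLASS-LIFTS-IMPLY-OBJECT-LIFTS for ONE finite locally free
carrier of `u + (liftable junk)` (the `d = 4`, all-Hodge-torsion-free variant of `FormalLiftingFromClassLifting` 13825; window `ext² ≤ 24`, no
rank `≤ 3` bundle, no l.c.i., no rank `0`; `{0,1}`-semiregularity ⇒ (⋆) is `PadicPridhamSemiregularity` 13815); CM anchors reduce supersingularly at the primes inert in
their CM field (density `1/2`), where Tate for supersingular K3 surfaces (Charles, Madapusi Pera, Maulik) + Künneth make every class of `W₀` a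
polynomial in divisor classes. -/
def stub_twinFormalSeeds : Prop :=
  ∀ (M N : Module.End ℂ (K3Index → ℂ)), Latt[M, N] →
    ∀ (μ : OrientationFamily), μ.HasPoincareDuality →
      ∀ (S₂ S₂' : SchemeOver ℂ) (hS₂ : IsK3Surface S₂) (hS₂' : IsK3Surface S₂')
        (η₂ : complexBetti S₂ (2 * 1) ≃ₗ[ℂ] (K3Index → ℂ)) (p₂ : complexBetti S₂ (2 * 2)) (x₂ : K3Index → ℂ)
        (η₂' : complexBetti S₂' (2 * 1) ≃ₗ[ℂ] (K3Index → ℂ)) (p₂' : complexBetti S₂' (2 * 2)) (x₂' : K3Index → ℂ),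
        MarkedK3[S₂, η₂, p₂, x₂] → PeriodPt[x₂] → MarkedK3[S₂', η₂', p₂', x₂'] → PeriodPt[x₂'] →
        (∃ t : ℂ, M x₂' = t • x₂) →
        ∀ D : TwinModel μ S₂ S₂' hS₂ hS₂' η₂ η₂' M, D.IsGenuine →
          PadicAnchor.DivisorClassesAreChern D.C (WittScheme.specialFibre D.𝒲) →
          PadicAnchor.RationallyLefschetz D.C (WittScheme.specialFibre D.𝒲) →
          D.u ∈ D.C.ratAlgebraicClasses (WittScheme.specialFibre D.𝒲) 2 → FormalSeeds[D]

/-- **Stub 5′ · stub_discSpread** (reshape r2 = the wave-1 worker's CORRECTED, twin-model-free form; true in print, formal XL, blocked on the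
definition gap "universal polarised `M`-twin family over a level cover of `D_h`" exactly like the sibling line's dropped `TwinSpread`).  For the
lattice datum, the route items, the facts and a polarisation `h`: if some marked `M`-twin pair is good at every `h`-polarised point of a set `T`
whose trace on `D_h` is NOT MEAGRE, then some marked `M`-twin pair is good at EVERY point of `D_h`.  Proof in print: over the universal
quasi-polarised `M`-twin family on a neat level cover `B̃ = Γ̃ \ D_h` the good locus is `⋃ⱼ Wⱼ(ℂ)` for countably many Zariski-closed `Wⱼ`
(`charlesSchnell_algebraicityLocus_iUnion_closed` / CDK); a non-meagre one has interior, hence is a whole component (irreducibility); the other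
component by complex conjugation of varieties; every point of `D_h` is `Γ̃`·(a period of a fibre) and re-marking by `(g, M⁻¹ g M)` keeps the twin
class; proportional periods by the landed `stub_periodInvariance`.  It contains the open-set shape (`discSpread_open_of_corrected`, worker file). -/
def stub_discSpread : Prop :=
  ∀ (M N : Module.End ℂ (K3Index → ℂ)), Latt[M, N] →
    ∀ (μ : OrientationFamily), μ.HasPoincareDuality → K3PeriodSurjective → HodgeIsometryAlgebraic → LineFacts[] →
      ∀ (h : K3Index → ℤ), 0 < ∑ i, ∑ j, h i * k3Gram i j * h j →
        ∀ T : Set (K3Index → ℂ), NonMeagre[h, T] →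
          (∀ z ∈ T, PolPeriod[h, z] → GoodPairAt[M, μ, z]) →
          ∀ z : K3Index → ℂ, PolPeriod[h, z] → GoodPairAt[M, μ, z]

/-! ## Sorry-free sanity lemmas -/

/-- The lattice datum of the line is the tree's explicit integral `2`-similitude (`U(2) ⊂ U`, sum/difference on `E₈(−1)^{⊕2}`). -/
theorem latt_witness : ∃ M N : Module.End ℂ (K3Index → ℂ), Latt[M, N] :=
  exists_twoSimilitude_k3Lattice

/-- An `h`-polarised period point (`h² > 0`) is a projective period point (witness `u = h`). -/
theorem periodPt_of_polPeriod {h : K3Index → ℤ} (hh : 0 < ∑ i, ∑ j, h i * k3Gram i j * h j)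
    {x : K3Index → ℂ} (hx : PolPeriod[h, x]) : PeriodPt[x] :=
  ⟨hx.1, hx.2.1, h, hx.2.2, hh⟩

/-- `CorrComp[]` (composition of algebraic correspondences between K3 surfaces) from the named fact
`cupProduct_mem_algebraicClasses_tripleProduct_surfaces`, by the tree's unconditional `corrComp_surfaces_of_cup'`. -/
theorem corrComp_of_cupAlg (hCUP : cupProduct_mem_algebraicClasses_tripleProduct_surfaces) : CorrComp[] :=
  fun μ hμ S S' S'' hS hS' hS'' =>
    corrComp_surfaces_of_cup' hCUP μ hμ S S' S'' (IsK3Surface.isSmoothProjective hS)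
      (IsK3Surface.isSmoothProjective hS') (IsK3Surface.isSmoothProjective hS'')

/-- **`DeRham[]` is a theorem of the tree** (`exists_deRhamIsoFamily_holds`, wave-1 worker on `stub_facts`): the three open facts give the
four-conjunct `LineFacts[]` consumed by the landed anchor theorem `stub_cmTwinAnchor`. -/
theorem lineFacts_of_openFacts (hF : OpenFacts[]) : LineFacts[] :=
  ⟨hF.1, hF.2.1, hF.2.2, fun E _ _ _ => Literature.NumberTheory.Transcendental.exists_deRhamIsoFamily_holds E⟩

/-- **Stub 2a · stub_polarisedCmNormPeriod** — LANDED (p109597, `Theorems/NikulinTwinTransportTwinTwistorTransportPolarisedCmNormPeriod.lean`);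
kept as a registered stub in this INTERIM file r3i only until the farm has built that module (then it is imported, file r3). -/
def stub_polarisedCmNormPeriod : Prop :=
  ∀ (h : K3Index → ℤ), 0 < ∑ i, ∑ j, h i * k3Gram i j * h j →
    ∃ x₁ : K3Index → ℂ, PolPeriod[h, x₁] ∧ CMNormPeriod[(2 : ℂ), x₁]

/-- **Stub 2b · stub_cmTwinAnchor** — LANDED (p109741, `Theorems/NikulinTwinTransportTwinTwistorTransportCmTwinAnchor.lean`); kept as a
registered stub in this INTERIM file r3i only until the farm has built that module (then it is imported, file r3). -/
def stub_cmTwinAnchor : Prop :=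
  ∀ (M N : Module.End ℂ (K3Index → ℂ)), Latt[M, N] →
    ∀ (μ : OrientationFamily), μ.HasPoincareDuality → K3PeriodSurjective → HodgeIsometryAlgebraic → LineFacts[] →
      ∀ (x₁ : K3Index → ℂ), PeriodPt[x₁] → CMNormPeriod[(2 : ℂ), x₁] →
        ∃ (S₁ S₁' : SchemeOver ℂ) (hS₁ : IsK3Surface S₁) (hS₁' : IsK3Surface S₁')
          (η₁ : complexBetti S₁ (2 * 1) ≃ₗ[ℂ] (K3Index → ℂ)) (p₁ : complexBetti S₁ (2 * 2))
          (η₁' : complexBetti S₁' (2 * 1) ≃ₗ[ℂ] (K3Index → ℂ)) (p₁' : complexBetti S₁' (2 * 2)) (x₁' : K3Index → ℂ),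
          MarkedK3[S₁, η₁, p₁, x₁] ∧ MarkedK3[S₁', η₁', p₁', x₁'] ∧ PeriodPt[x₁'] ∧
          (∃ t : ℂ, M x₁' = t • x₁) ∧ HasComplexMultiplication S₁ ∧
          Good[M, μ, S₁, S₁', hS₁, hS₁', η₁, η₁']

/-- **The planner's heart from the smaller research stub + Grothendieck existence (reshape r3, the cut along the sibling engine).**
`stub_twinFormalSeeds` puts `N • u` in the closure of `ch₂^cris` of formally liftable modules; `FormalVectorBundlesAlgebraize` (route
PadicSemiregularLift crux 14106, by name) algebraizes them; `bo(ch₂^cris(E|₀)) = ch₂^dR(E_K) ∈ A²(W_K)` and `ℚ`-saturation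
(`bo_mem_span_of_formalSeedClasses`); `bo u = γ_dR`. -/
theorem twinPVHC_of_formalSeeds
    (hP3a : Summit.HodgeConjecture.HodgeConjecture.Theses.PadicSemiregularLift.FormalVectorBundlesAlgebraize)
    (hS : stub_twinFormalSeeds) : TwinPVHC[] := by
  intro M N hlatt μ hμ S₂ S₂' hS₂ hS₂' η₂ p₂ x₂ η₂' p₂' x₂' hm hx hm' hx' hper D hG hDC hRL hu
  obtain ⟨N₀, hN₀, hcl⟩ := hS M N hlatt μ hμ S₂ S₂' hS₂ hS₂' η₂ p₂ x₂ η₂' p₂' x₂' hm hx hm' hx' hper D hG hDC hRL hu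
  have key := Summit.HodgeConjecture.HodgeConjecture.Cruxes.HodgeAbelianVarieties.InnerFormInvariantSeeds.Engine.bo_mem_span_of_formalSeedClasses
    hP3a D.C D.model (r := 2) hN₀ hcl
  rw [D.bo_u] at key
  exact key

/-- **Goodness from the heart at a period carrying a model**: `ModelAt[M, μ, z]` + `TwinPVHC[]` + the glue `good_of_mem_span` give
`GoodPairAt[M, μ, z]`. -/
theorem goodPairAt_of_modelAt (hH : TwinPVHC[]) (M N : Module.End ℂ (K3Index → ℂ)) (hlatt : Latt[M, N])
    (μ : OrientationFamily) (hμ : μ.HasPoincareDuality) (z : K3Index → ℂ) (hz : ModelAt[M, μ, z]) : GoodPairAt[M, μ, z] := by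
  obtain ⟨S, S', hS, hS', η, p, η', p', x', hm, hx, hm', hx', hper, D, hG, hDC, hRL, hu⟩ := hz
  exact ⟨S, S', hS, hS', η, p, η', p', x', hm, hx, hm', hx', hper,
    D.good_of_mem_span hG (hH M N hlatt μ hμ S S' hS hS' η p z η' p' x' hm hx hm' hx' hper D hG hDC hRL hu)⟩

/-- **Tightness of the heart, downward (honesty lemma).**  On a twin model with cycle descent, if the twin class `γB` is algebraic on
`S × S'` then `γ_dR ∈ K · A²(W_K)`. -/
theorem twinPVHC_conclusion_of_algebraic {μ : OrientationFamily} {S S' : SchemeOver ℂ} {hS : IsK3Surface S}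
    {hS' : IsK3Surface S'} {η : complexBetti S (2 * 1) ≃ₗ[ℂ] (K3Index → ℂ)}
    {η' : complexBetti S' (2 * 1) ≃ₗ[ℂ] (K3Index → ℂ)} {M : Module.End ℂ (K3Index → ℂ)}
    (D : TwinModel μ S S' hS hS' η η' M) (hdesc : D.CycleDescent)
    (halg : D.γB ∈ algebraicClasses (MonoidalCategoryStruct.tensorObj S S') 2) :
    D.γdR ∈ Submodule.span K(D.p, D.k)
      (D.C.dR.ratAlgebraicClasses (WittScheme.genericFibre D.𝒲) 2 :
        Set (D.C.dR.obj (WittScheme.genericFibre D.𝒲) (2 * 2))) := by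
  refine hdesc 2 D.γdR ?_
  rw [D.cmp_γdR]
  exact halg

/-- **The planner's heart is at most HC-strength modulo cycle descent**: it follows from the Hodge conjecture for the products `S ⊗ S'` of
projective K3 surfaces together with `CycleDescent` at the model (the residual `K`-rationality of the algebraic representative), so a
counterexample to `TwinPVHC[]` is a non-algebraic Hodge class on a product of two projective K3 surfaces or a failure of descent to `K`. -/
theorem twinPVHC_of_hodgeConjectureFor
    (hHC : ∀ (S S' : SchemeOver ℂ), IsK3Surface S → IsK3Surface S' →
      HodgeConjectureFor 4 (MonoidalCategoryStruct.tensorObj S S'))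
    (hdesc : ∀ (μ : OrientationFamily) (S S' : SchemeOver ℂ) (hS : IsK3Surface S) (hS' : IsK3Surface S')
      (η : complexBetti S (2 * 1) ≃ₗ[ℂ] (K3Index → ℂ)) (η' : complexBetti S' (2 * 1) ≃ₗ[ℂ] (K3Index → ℂ))
      (M : Module.End ℂ (K3Index → ℂ)) (D : TwinModel μ S S' hS hS' η η' M), D.IsGenuine → D.CycleDescent) : TwinPVHC[] := by
  intro M N _ μ _ S₂ S₂' hS₂ hS₂' η₂ p₂ x₂ η₂' p₂' x₂' _ _ _ _ _ D hG _ _ _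
  exact twinPVHC_conclusion_of_algebraic D (hdesc μ S₂ S₂' hS₂ hS₂' η₂ η₂' M D hG)
    ((hHC S₂ S₂' hS₂ hS₂').2 2 D.γB hG.rational hG.hodgeType)

/-! ## Registered stubs (sorried witnesses `Stub.stub_*`, statements verbatim; `sorry` occurs nowhere else in this file; the `def stub_* : Prop`
above carry the same short names so that the hypotheses of `TwinTwistorTransport_of` are the declared stubs BY NAME for the skeleton audit) -/

namespace Stub

/-- Stub 1 (registered, reshape r2): see `stub_facts`. -/
theorem stub_facts : Huybrechts_K3_marking_exists ∧ cupProduct_mem_algebraicClasses_tripleProduct_surfaces ∧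
    Buskin2019_hodgeConjectureFor_square_of_CM := by
  sorry

/-- Stub 2a — LANDED p109597 (`Theorems.NikulinTwinTransport.OrdinaryPrimeAnchors.stub_polarisedCmNormPeriod`, verbatim); no longer a
stub since lead reshape r5. -/
theorem stub_polarisedCmNormPeriod : ∀ (h : K3Index → ℤ), 0 < ∑ i, ∑ j, h i * k3Gram i j * h j →
    ∃ x₁ : K3Index → ℂ, PolPeriod[h, x₁] ∧ CMNormPeriod[(2 : ℂ), x₁] :=
  Summit.HodgeConjecture.HodgeConjecture.Theorems.NikulinTwinTransport.OrdinaryPrimeAnchors.stub_polarisedCmNormPeriod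

/-- Stub 2b — LANDED p109741 (`Theorems.NikulinTwinTransport.OrdinaryPrimeAnchors.stub_cmTwinAnchor`, verbatim); no longer a stub since
lead reshape r5. -/
theorem stub_cmTwinAnchor : ∀ (M N : Module.End ℂ (K3Index → ℂ)), Latt[M, N] →
    ∀ (μ : OrientationFamily), μ.HasPoincareDuality → K3PeriodSurjective → HodgeIsometryAlgebraic → LineFacts[] →
      ∀ (x₁ : K3Index → ℂ), PeriodPt[x₁] → CMNormPeriod[(2 : ℂ), x₁] →
        ∃ (S₁ S₁' : SchemeOver ℂ) (hS₁ : IsK3Surface S₁) (hS₁' : IsK3Surface S₁')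
          (η₁ : complexBetti S₁ (2 * 1) ≃ₗ[ℂ] (K3Index → ℂ)) (p₁ : complexBetti S₁ (2 * 2))
          (η₁' : complexBetti S₁' (2 * 1) ≃ₗ[ℂ] (K3Index → ℂ)) (p₁' : complexBetti S₁' (2 * 2)) (x₁' : K3Index → ℂ),
          MarkedK3[S₁, η₁, p₁, x₁] ∧ MarkedK3[S₁', η₁', p₁', x₁'] ∧ PeriodPt[x₁'] ∧
          (∃ t : ℂ, M x₁' = t • x₁) ∧ HasComplexMultiplication S₁ ∧
          Good[M, μ, S₁, S₁', hS₁, hS₁', η₁, η₁'] :=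
  Summit.HodgeConjecture.HodgeConjecture.Theorems.NikulinTwinTransport.OrdinaryPrimeAnchors.stub_cmTwinAnchor

/-- Stub 3′ (registered, reshape r2): see `stub_divisorialDiscModels`. -/
theorem stub_divisorialDiscModels : ∀ (M N : Module.End ℂ (K3Index → ℂ)), Latt[M, N] →
    ∀ (μ : OrientationFamily), μ.HasPoincareDuality → K3PeriodSurjective → HodgeIsometryAlgebraic → LineFacts[] →
      ∀ (h : K3Index → ℤ), 0 < ∑ i, ∑ j, h i * k3Gram i j * h j →
        ∀ (S₁ S₁' : SchemeOver ℂ) (hS₁ : IsK3Surface S₁) (hS₁' : IsK3Surface S₁')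
          (η₁ : complexBetti S₁ (2 * 1) ≃ₗ[ℂ] (K3Index → ℂ)) (p₁ : complexBetti S₁ (2 * 2)) (x₁ : K3Index → ℂ)
          (η₁' : complexBetti S₁' (2 * 1) ≃ₗ[ℂ] (K3Index → ℂ)) (p₁' : complexBetti S₁' (2 * 2)) (x₁' : K3Index → ℂ),
          MarkedK3[S₁, η₁, p₁, x₁] → PolPeriod[h, x₁] → MarkedK3[S₁', η₁', p₁', x₁'] → PeriodPt[x₁'] →
          (∃ t : ℂ, M x₁' = t • x₁) → HasComplexMultiplication S₁ → Good[M, μ, S₁, S₁', hS₁, hS₁', η₁, η₁'] →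
          ∃ T : Set (K3Index → ℂ), NonMeagre[h, T] ∧ ∀ z ∈ T, PolPeriod[h, z] → ModelAt[M, μ, z] := by
  sorry

/-- Stub 4′ (registered, reshape r3): see `stub_twinFormalSeeds`. -/
theorem stub_twinFormalSeeds : ∀ (M N : Module.End ℂ (K3Index → ℂ)), Latt[M, N] →
    ∀ (μ : OrientationFamily), μ.HasPoincareDuality →
      ∀ (S₂ S₂' : SchemeOver ℂ) (hS₂ : IsK3Surface S₂) (hS₂' : IsK3Surface S₂')
        (η₂ : complexBetti S₂ (2 * 1) ≃ₗ[ℂ] (K3Index → ℂ)) (p₂ : complexBetti S₂ (2 * 2)) (x₂ : K3Index → ℂ)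
        (η₂' : complexBetti S₂' (2 * 1) ≃ₗ[ℂ] (K3Index → ℂ)) (p₂' : complexBetti S₂' (2 * 2)) (x₂' : K3Index → ℂ),
        MarkedK3[S₂, η₂, p₂, x₂] → PeriodPt[x₂] → MarkedK3[S₂', η₂', p₂', x₂'] → PeriodPt[x₂'] →
        (∃ t : ℂ, M x₂' = t • x₂) →
        ∀ D : TwinModel μ S₂ S₂' hS₂ hS₂' η₂ η₂' M, D.IsGenuine →
          PadicAnchor.DivisorClassesAreChern D.C (WittScheme.specialFibre D.𝒲) →
          PadicAnchor.RationallyLefschetz D.C (WittScheme.specialFibre D.𝒲) →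
          D.u ∈ D.C.ratAlgebraicClasses (WittScheme.specialFibre D.𝒲) 2 → FormalSeeds[D] := by
  sorry

/-- Stub 5′ (registered, reshape r2): see `stub_discSpread`. -/
theorem stub_discSpread : ∀ (M N : Module.End ℂ (K3Index → ℂ)), Latt[M, N] →
    ∀ (μ : OrientationFamily), μ.HasPoincareDuality → K3PeriodSurjective → HodgeIsometryAlgebraic → LineFacts[] →
      ∀ (h : K3Index → ℤ), 0 < ∑ i, ∑ j, h i * k3Gram i j * h j →
        ∀ T : Set (K3Index → ℂ), NonMeagre[h, T] →
          (∀ z ∈ T, PolPeriod[h, z] → GoodPairAt[M, μ, z]) →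
          ∀ z : K3Index → ℂ, PolPeriod[h, z] → GoodPairAt[M, μ, z] := by
  sorry

end Stub

/-! ## The composition (kernel-checked; no `sorry` below this line) -/

/-- **Twin transport along road (a), reshape r2.**  Period surjectivity and Buskin (route items by name), the three open facts, the two LANDED
anchor theorems (used inside the proof since r5), Grothendieck existence (`FormalVectorBundlesAlgebraize`, sibling route crux 14106, by name), the three stubs and the landed `stub_periodInvariance` give `TwinTransportFor[M]` for the tree's lattice `2`-similitude `M`:
for a marked `M`-twin pair `(S, η, p, x; S', η', p', x')` the projective period `x` supplies a polarisation `h`; an `h`-polarised CM-norm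
period (landed 2a) carries a good CM twin anchor (landed 2b); twin models with divisorial special fibre on a non-meagre set of periods of `D_h` (stub 3′);
goodness there from the heart (stub 4′ + glue); spreading over `D_h` (stub 5′); re-marking (landed). -/
theorem twinTransport_of (hP : K3PeriodSurjective) (hB : HodgeIsometryAlgebraic)
    (hP3a : Summit.HodgeConjecture.HodgeConjecture.Theses.PadicSemiregularLift.FormalVectorBundlesAlgebraize) (hF : stub_facts)
    (hO : stub_divisorialDiscModels) (hS4 : stub_twinFormalSeeds) (hD : stub_discSpread) :
    ∃ (M N : Module.End ℂ (K3Index → ℂ)), Latt[M, N] ∧ TwinTransportFor[M] := by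
  have hL : stub_polarisedCmNormPeriod := Stub.stub_polarisedCmNormPeriod
  have hA : stub_cmTwinAnchor := Stub.stub_cmTwinAnchor
  have hH : TwinPVHC[] := twinPVHC_of_formalSeeds hP3a hS4
  obtain ⟨M, N, hlatt⟩ := latt_witness
  refine ⟨M, N, hlatt, ?_⟩
  intro μ hμ S S' hS hS' η p x η' p' x' hm hx hm' hx' hper
  have hF' : LineFacts[] := lineFacts_of_openFacts hF
  obtain ⟨hxx, hxpos, h, hhx, hhpos⟩ := hx
  -- the CM twin anchor on `D_h` (landed 2a + 2b)
  obtain ⟨x₁, hpol₁, hcm₁⟩ := hL h hhpos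
  obtain ⟨S₁, S₁', hS₁, hS₁', η₁, p₁, η₁', p₁', x₁', hm₁, hm₁', hx₁', hper₁, hCM₁, hgood₁⟩ :=
    hA M N hlatt μ hμ hP hB hF' x₁ (periodPt_of_polPeriod hhpos hpol₁) hcm₁
  -- twin models with divisorial special fibre on a non-meagre set of periods of `D_h` (stub 3′)
  obtain ⟨T, hT, hmod⟩ := hO M N hlatt μ hμ hP hB hF' h hhpos S₁ S₁' hS₁ hS₁' η₁ p₁ x₁ η₁' p₁' x₁' hm₁ hpol₁ hm₁' hx₁'
    hper₁ hCM₁ hgood₁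
  -- goodness there from the heart (stub 4 + glue)
  have hgoodT : ∀ z ∈ T, PolPeriod[h, z] → GoodPairAt[M, μ, z] := fun z hzT hz =>
    goodPairAt_of_modelAt hH M N hlatt μ hμ z (hmod z hzT hz)
  -- spreading over `D_h` (stub 5′)
  have hgood : GoodPairAt[M, μ, x] := hD M N hlatt μ hμ hP hB hF' h hhpos T hT hgoodT x ⟨hxx, hxpos, hhx⟩
  -- re-marking (Buskin): the landed `stub_periodInvariance` (p95441)
  exact Summit.HodgeConjecture.HodgeConjecture.Theorems.NikulinTwinTransport.stub_periodInvariance M N hlatt μ hμ hB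
    Huybrechts_K3_hodgeTypes_H2_holds (corrComp_of_cupAlg hF'.2.1) x hgood S S' hS hS' η p x η' p' x' hm
    ⟨hxx, hxpos, h, hhx, hhpos⟩ hm' hx' hper ⟨1, (one_smul ℂ x).symm⟩

/-- **`TwinTwistorTransport_of` — the line's composition, concluding the route declaration
`Summit.HodgeConjecture.HodgeConjecture.Theses.NikulinTwinTransport.TwinTwistorTransport` BY NAME.**  Hypotheses: the route items
`K3PeriodSurjective` (crux 15154), `HodgeIsometryAlgebraic` (support 13675) and the sibling route's `PadicSemiregularLift.FormalVectorBundlesAlgebraize` (crux 14106) by name, and exactly the four open stub statements (r5: the two landed anchor theorems are called inside `twinTransport_of`).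
Last step: the landed reduction `twinTwistorTransport_of_twinTransport` (p85563). -/
theorem TwinTwistorTransport_of (hP : K3PeriodSurjective) (hB : HodgeIsometryAlgebraic)
    (hP3a : Summit.HodgeConjecture.HodgeConjecture.Theses.PadicSemiregularLift.FormalVectorBundlesAlgebraize) (hF : stub_facts)
    (hO : stub_divisorialDiscModels) (hS4 : stub_twinFormalSeeds) (hD : stub_discSpread) : TwinTwistorTransport := by
  obtain ⟨M, N, ⟨-, hNrat, hMN, hNM, hM2⟩, htw⟩ := twinTransport_of hP hB hP3a hF hO hS4 hD
  have hF' : OpenFacts[] := hF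
  exact twinTwistorTransport_of_twinTransport hP hF'.1 Huybrechts_K3_hodgeTypes_H2_holds M N hNrat hMN hNM hM2 htw

/-- **The skeleton with the registered stubs plugged in**: modulo the three route items the four open `Stub.stub_*` theorems prove the crux
`TwinTwistorTransport` (closed modulo their `sorry`s; becomes the crux proof when the last stub lands). -/
theorem TwinTwistorTransport_skeleton (hP : K3PeriodSurjective) (hB : HodgeIsometryAlgebraic)
    (hP3a : Summit.HodgeConjecture.HodgeConjecture.Theses.PadicSemiregularLift.FormalVectorBundlesAlgebraize) : TwinTwistorTransport :=
  TwinTwistorTransport_of hP hB hP3a Stub.stub_facts Stub.stub_divisorialDiscModels Stub.stub_twinFormalSeeds Stub.stub_discSpread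

end Summit.HodgeConjecture.HodgeConjecture.Cruxes.TwinTwistorTransport.OrdinaryPrimeAnchors

end
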